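import Literature.Computability.Complexity.IKWGeneratorsProofs
import Literature.Computability.Complexity.UniversalWitnessCircuitsGenerator
import HarnessLib

/-!
# Discharges of named facts of `Williams2014Transfer.lean`

`Literature/Computability/Complexity/Williams2014TransferHolds.lean` — proofs-only sibling of
`Williams2014Transfer.lean` (no definitions, no named facts). Each theorem below closes a
named fact `X : Prop` of that file as `X_holds : X` by composing an ACCEPTED reduction theorem
of the tree with the ACCEPTED unconditional `_holds` discharges of all of its hypotheses;
nothing is re-proved and no statement is changed. Recorded by the librarian sweep g25
(2026-08-16, pass 5c: facts dischargeable in one line from the tree's own lemmas), so that the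
facts census, `#h21_route_deps` and the cone guardrail see these facts as theorems.

Discharged here:

* `Williams2014_thm_5_2_holds` := `Williams2014_thm_5_2_of_thm12_2` `IKW2002_thm12_2_holds`
  (`UniversalWitnessCircuitsGenerator.lean`).
* `Williams2014_thm_5_1_holds` := `Williams2014_thm_5_1_of_thm12_2` `IKW2002_thm12_2_holds`
  (`UniversalWitnessCircuitsGenerator.lean`).

## References

* [Williams2014] — see `lean/references.bib` and the docstring of the fact in `Williams2014Transfer.lean`.
-/

namespace Literature.Computability.Complexity

/-- **Discharge of the named fact `Williams2014_thm_5_2`** (`Williams2014Transfer.lean`): Williams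
2014, Thm. 5.2 (Impagliazzo–Kabanets–Wigderson 2002; Williams 2010): "If `NEXP ⊆ P/poly` then
every language in `NEXP` has universal witness circuits of polynomial size." Over the tree's
`NEXP`, `PPoly` and verifier-form `NTIME` … — obtained as `Williams2014_thm_5_2_of_thm12_2`
applied to the tree's unconditional discharge `IKW2002_thm12_2_holds` of its hypothesis
(reduction in `UniversalWitnessCircuitsGenerator.lean`).
[cite: Williams2014, Thm. 5.2] -/
theorem Williams2014_thm_5_2_holds :
    Williams2014_thm_5_2 :=
  Williams2014_thm_5_2_of_thm12_2 IKW2002_thm12_2_holds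

/-- **Discharge of the named fact `Williams2014_thm_5_1`** (`Williams2014Transfer.lean`): Williams
2014, Thm. 5.1 ([Wil10]; "follows immediately from" Thm. 5.2): "Suppose `NEXP` has polynomial
size circuits. … — obtained as `Williams2014_thm_5_1_of_thm12_2` applied to the tree's
unconditional discharge `IKW2002_thm12_2_holds` of its hypothesis (reduction in
`UniversalWitnessCircuitsGenerator.lean`).
[cite: Williams2014, Thm. 5.1] -/
theorem Williams2014_thm_5_1_holds :
    Williams2014_thm_5_1 :=
  Williams2014_thm_5_1_of_thm12_2 IKW2002_thm12_2_holds

end Literature.Computability.Complexity
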